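import Summits.QuantumFields.BalabanUV.T4Continuum.Support.CovariantVectorCoercive
import Summits.QuantumFields.BalabanUV.T4Continuum.Support.SubstrateRawSpecies

/-!
# T⁴ programme, SUBSTRATE (shared lattice-gauge analysis library) — THE O-3′ JUNCTION: p1's operator of record `deltaQOf c a Γ U`
# (`Δ_U + a·Q_k(U)ᴴQ_k(U)` on `ι`-valued vector fields, `SubstrateCovariantAveraging`) IS `vecOp` at the transporters of `U`, hence is
# COERCIVE, INVERTIBLE and has a BOUNDED inverse `greenOf` at every REGULAR background — `isUnit_deltaQOf_of_regular`, `opNorm_greenOf_le_of_regular`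
# (junction J-3a of MAP v0.4 §O1 O-3′: «invertibility is NOT claimed; where a row needs it, it is DISPLAYED and discharged by p3's coercivity road»)

Substrate cell `b2b-balaban-substrate-*`, seat p3 (typer NEXT v0.4 item 2).  With the printed lattice factor `c = L^k = lev P.L k` and the printed
mass normalisation `a = a′·(L^k)^d` (`Q* = n^dQᴴ`, [Balaban1984PropagatorsI] (1.18)∕(1.69)):
 * **`deltaQOf_eq_vecOp`**: `deltaQOf P ι h (lev) (a′·lev^d) Γ U = CovariantVectorCoercive.vecOp (lev P.L k) (unitMod P) a′ Γ (transV (siteIdx P h) ι U)` (`rfl`);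
 * the size letter: `connM … (transV … U) ν i = lev·(ι(U b) − 1)`, so `lev·dist1(U b) ≤ α` for all bonds gives `‖n(R − 1)‖ ≤ α` (`norm_connM_transV_le`)
   and, for the standard contour system `CovariantBlockAveraging.contour`, `‖T(Γ) − 1‖ ≤ e^{(d+1)α} − 1` (`norm_transport_transV_contour_le`);
 * **`coercive_deltaQOf_of_regular`**: `Coercive (gammaV (card o) d a′ α τ) (deltaQOf … (lev) (a′·lev^d) Γ U)` under `lev·dist1(U b) ≤ α` and the
   contour-transport letter `τ`; **`isUnit_deltaQOf_of_regular`**, **`opNorm_greenOf_le_of_regular`** (`‖greenOf‖ ≤ 1/gammaV`),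
   `deltaQOf_mul_greenOf`∕`greenOf_mul_deltaQOf` (`= 1`), and the standard-contour forms `…_contour` with `τ = e^{(d+1)α} − 1` — every constant
   free of the level `k` and of the torus.
READING NOTE for the instancer (p1's `covAtOfRecord … c a (s k) (Γ k)` passes ONE `c` and ONE `a` for all `k`): the level-free statements are at
`c = lev P.L k`, `a = a′·(lev P.L k)^d` — level-DEPENDENT letters; at other values the operator is a rescaling whose constants carry powers of `L^k`.
What is NOT here: the decay of the entries of `greenOf` (needs the row defects of `vecOp`, file J-2) and the gauge term (programme VEC).

HONEST FRAMING (T4-DAG p. 1).  MODEL-level linear algebra ([folklore]; one region, global small field `lev·dist1(U b) ≤ α` on EVERY bond, constants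
OURS); nothing printed is a hypothesis; no `def … : Prop`; spine 0/9 unchanged; NOT infinite volume ∕ mass gap ∕ Clay.  HONEST DEPENDENCY: continuum
YM on T⁴ ⇐ BetaPertH ∧ nine spine estimates (0/9 proved); BetaPertH ⇐ (D1) ∧ (D4) ∧ CAP+tail; G-an2-4 gates asym, D1 and NE2/3/4.  ABSOLUTE RULE
kept; no `sorry`.
-/

noncomputable section

open scoped BigOperators ComplexConjugate Matrix Matrix.Norms.L2Operator Kronecker ComplexOrder

namespace Summit.QuantumFields.BalabanUV.T4Continuum.CovariantVectorGreenOfField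

open Literature.MathematicalPhysics.QuantumFieldTheory.Balaban1983to89
open Literature.MathematicalPhysics.QuantumFieldTheory.Balaban1983to89.B5Prop11Plancherel (Tor fine)
open Literature.MathematicalPhysics.QuantumFieldTheory.Balaban1983to89.B5G183RateUnitTower (lev lev_neZero)
open Summit.QuantumFields.BalabanUV.T4Continuum
open Summit.QuantumFields.BalabanUV.T4Continuum.ColourCovariantLaplacian (connM)
open Summit.QuantumFields.BalabanUV.T4Continuum.CovariantBlockAveraging (transport ContourSystem contour norm_transport_sub_one_le length_contour_le
  pow_sub_one_le_exp)
open Summit.QuantumFields.BalabanUV.T4Continuum.CoerciveInverseTower (Coercive isUnit_of_coercive opNorm_inv_le_of_coercive)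
open Summit.QuantumFields.BalabanUV.T4Continuum.SubstrateBackgroundTransporters
open Summit.QuantumFields.BalabanUV.T4Continuum.SubstrateCovariantAveraging (deltaQOf)
open Summit.QuantumFields.BalabanUV.T4Continuum.SubstrateRawSpecies (greenOf)
open Summit.QuantumFields.BalabanUV.T4Continuum.CovariantVectorCoercive (vecOp gammaV coercive_vecOp)

variable (P : Params) {G : Type*} [GaugeGroup G] {o : Type*} [Fintype o] [DecidableEq o] (ι : G →* Matrix o o ℂ)
variable {j k : ℕ} (h : j + k = P.K)

/-- `lev P.L k ≠ 0` as an instance (the tree's `lev_neZero`). [folklore] -/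
instance instNeZeroLev : NeZero (lev P.L k) := lev_neZero P.L k

/-! ## §1 The operator of record is `vecOp` at the transporters of `U` -/

/-- **`deltaQOf = vecOp ∘ transV`** at the printed letters `c = lev`, `a = a′·lev^d`. [folklore] -/
theorem deltaQOf_eq_vecOp (a' : ℝ) (Γ : ContourSystem P.d (lev P.L k) (unitMod P)) (U : GaugeField P j G) :
    deltaQOf P ι h ((lev P.L k : ℕ) : ℂ) (a' * ((lev P.L k : ℕ) : ℝ) ^ P.d) Γ U
      = vecOp (lev P.L k) (unitMod P) a' Γ (transV (siteIdx P h) ι U) := rfl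

/-! ## §2 The size letters of a regular background -/

variable {α : ℝ}

/-- `‖lev·(ι(U b) − 1)‖ ≤ α` from `lev·dist1(U b) ≤ α` (`‖ι g − 1‖ = dist1 g`). [folklore] -/
theorem norm_connM_transV_le (hdist : ∀ g : G, ‖ι g - 1‖ = dist1 g) {U : GaugeField P j G}
    (hU : ∀ b : PBond P j, ((lev P.L k : ℕ) : ℝ) * dist1 (U b) ≤ α) (ν : Fin P.d) (i : Tor (fine (lev P.L k) (unitMod P)) × Fin P.d) :
    ‖connM (fine (lev P.L k) (unitMod P)) ((lev P.L k : ℕ) : ℂ) (transV (siteIdx P h) ι U) ν i‖ ≤ α := by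
  rw [connM, norm_smul, Complex.norm_natCast, norm_transV_sub_one (siteIdx P h) hdist]
  exact hU _

/-- the bond letter `‖ι(U b) − 1‖ ≤ α/lev`. [folklore] -/
theorem norm_transV_sub_one_le (hdist : ∀ g : G, ‖ι g - 1‖ = dist1 g) {U : GaugeField P j G}
    (hU : ∀ b : PBond P j, ((lev P.L k : ℕ) : ℝ) * dist1 (U b) ≤ α) (ν : Fin P.d) (i : Tor (fine (lev P.L k) (unitMod P)) × Fin P.d) :
    ‖transV (siteIdx P h) ι U ν i - 1‖ ≤ α / (lev P.L k : ℕ) := by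
  have hn : (0 : ℝ) < (lev P.L k : ℕ) := by exact_mod_cast Nat.pos_of_ne_zero (NeZero.ne _)
  rw [norm_transV_sub_one (siteIdx P h) hdist, le_div_iff₀ hn, mul_comm]
  exact hU _

/-- **the contour-transport letter for the standard contours**: `‖T(Γ_{y,j,μ,t}) − 1‖ ≤ e^{(d+1)α} − 1`. [folklore] -/
theorem norm_transport_transV_contour_le (hdist : ∀ g : G, ‖ι g - 1‖ = dist1 g) (hα : 0 ≤ α) {U : GaugeField P j G}
    (hU : ∀ b : PBond P j, ((lev P.L k : ℕ) : ℝ) * dist1 (U b) ≤ α) (y : Tor (unitMod P)) (jj : Fin P.d → Fin (lev P.L k)) (μ : Fin P.d)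
    (t : Fin (lev P.L k)) :
    ‖transport (fine (lev P.L k) (unitMod P)) (transV (siteIdx P h) ι U) μ (contour (lev P.L k) (unitMod P) y jj μ t) - 1‖
      ≤ Real.exp ((P.d + 1 : ℕ) * α) - 1 := by
  have hn : 0 < lev P.L k := Nat.pos_of_ne_zero (NeZero.ne _)
  exact (norm_transport_sub_one_le (fine (lev P.L k) (unitMod P)) (by positivity) (norm_transV_sub_one_le P ι h hdist hU) μ
    (length_contour_le (lev P.L k) (unitMod P) y jj μ t.is_lt)).trans (pow_sub_one_le_exp hα (P.d + 1) (lev P.L k) hn)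

/-! ## §3 Coercivity, invertibility and the bounded inverse at a regular background -/

variable {a' τ : ℝ} {Γ : ContourSystem P.d (lev P.L k) (unitMod P)} {U : GaugeField P j G}

/-- **COERCIVITY OF THE OPERATOR OF RECORD**: `Coercive (gammaV (card o) d a′ α τ) (deltaQOf … (lev) (a′·lev^d) Γ U)` at a regular background
(`lev·dist1(U b) ≤ α` on every bond) with contour-transport letter `τ` — level-free. [folklore] -/
theorem coercive_deltaQOf_of_regular (hdist : ∀ g : G, ‖ι g - 1‖ = dist1 g) (ha' : 0 < a') (hα : 0 ≤ α) (hτ : 0 ≤ τ)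
    (hU : ∀ b : PBond P j, ((lev P.L k : ℕ) : ℝ) * dist1 (U b) ≤ α)
    (hT : ∀ y jj μ (t : Fin (lev P.L k)), ‖transport (fine (lev P.L k) (unitMod P)) (transV (siteIdx P h) ι U) μ (Γ y jj μ t) - 1‖ ≤ τ) :
    Coercive (gammaV (Fintype.card o) P.d a' α τ) (deltaQOf P ι h ((lev P.L k : ℕ) : ℂ) (a' * ((lev P.L k : ℕ) : ℝ) ^ P.d) Γ U) := by
  rw [deltaQOf_eq_vecOp]
  exact coercive_vecOp (lev P.L k) (unitMod P) ha' hα hτ (norm_connM_transV_le P ι h hdist hU) hT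

/-- **`isUnit_deltaQOf_of_regular`** (O-3′'s displayed invertibility, DISCHARGED at regular backgrounds when `gammaV > 0`). [folklore] -/
theorem isUnit_deltaQOf_of_regular (hdist : ∀ g : G, ‖ι g - 1‖ = dist1 g) (ha' : 0 < a') (hα : 0 ≤ α) (hτ : 0 ≤ τ)
    (hU : ∀ b : PBond P j, ((lev P.L k : ℕ) : ℝ) * dist1 (U b) ≤ α)
    (hT : ∀ y jj μ (t : Fin (lev P.L k)), ‖transport (fine (lev P.L k) (unitMod P)) (transV (siteIdx P h) ι U) μ (Γ y jj μ t) - 1‖ ≤ τ)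
    (hγ : 0 < gammaV (Fintype.card o) P.d a' α τ) :
    IsUnit (deltaQOf P ι h ((lev P.L k : ℕ) : ℂ) (a' * ((lev P.L k : ℕ) : ℝ) ^ P.d) Γ U) :=
  isUnit_of_coercive hγ (coercive_deltaQOf_of_regular P ι h hdist ha' hα hτ hU hT)

/-- the determinant form. [folklore] -/
theorem isUnit_det_deltaQOf_of_regular (hdist : ∀ g : G, ‖ι g - 1‖ = dist1 g) (ha' : 0 < a') (hα : 0 ≤ α) (hτ : 0 ≤ τ)
    (hU : ∀ b : PBond P j, ((lev P.L k : ℕ) : ℝ) * dist1 (U b) ≤ α)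
    (hT : ∀ y jj μ (t : Fin (lev P.L k)), ‖transport (fine (lev P.L k) (unitMod P)) (transV (siteIdx P h) ι U) μ (Γ y jj μ t) - 1‖ ≤ τ)
    (hγ : 0 < gammaV (Fintype.card o) P.d a' α τ) :
    IsUnit (deltaQOf P ι h ((lev P.L k : ℕ) : ℂ) (a' * ((lev P.L k : ℕ) : ℝ) ^ P.d) Γ U).det :=
  (Matrix.isUnit_iff_isUnit_det _).mp (isUnit_deltaQOf_of_regular P ι h hdist ha' hα hτ hU hT hγ)

/-- `Δ·G = 1` for the operator of record and its Green's function. [folklore] -/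
theorem deltaQOf_mul_greenOf (hdist : ∀ g : G, ‖ι g - 1‖ = dist1 g) (ha' : 0 < a') (hα : 0 ≤ α) (hτ : 0 ≤ τ)
    (hU : ∀ b : PBond P j, ((lev P.L k : ℕ) : ℝ) * dist1 (U b) ≤ α)
    (hT : ∀ y jj μ (t : Fin (lev P.L k)), ‖transport (fine (lev P.L k) (unitMod P)) (transV (siteIdx P h) ι U) μ (Γ y jj μ t) - 1‖ ≤ τ)
    (hγ : 0 < gammaV (Fintype.card o) P.d a' α τ) :
    deltaQOf P ι h ((lev P.L k : ℕ) : ℂ) (a' * ((lev P.L k : ℕ) : ℝ) ^ P.d) Γ U * greenOf P ι h ((lev P.L k : ℕ) : ℂ) (a' * ((lev P.L k : ℕ) : ℝ) ^ P.d) Γ U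
      = 1 := by
  rw [greenOf]; exact Matrix.mul_nonsing_inv _ (isUnit_det_deltaQOf_of_regular P ι h hdist ha' hα hτ hU hT hγ)

/-- `G·Δ = 1`. [folklore] -/
theorem greenOf_mul_deltaQOf (hdist : ∀ g : G, ‖ι g - 1‖ = dist1 g) (ha' : 0 < a') (hα : 0 ≤ α) (hτ : 0 ≤ τ)
    (hU : ∀ b : PBond P j, ((lev P.L k : ℕ) : ℝ) * dist1 (U b) ≤ α)
    (hT : ∀ y jj μ (t : Fin (lev P.L k)), ‖transport (fine (lev P.L k) (unitMod P)) (transV (siteIdx P h) ι U) μ (Γ y jj μ t) - 1‖ ≤ τ)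
    (hγ : 0 < gammaV (Fintype.card o) P.d a' α τ) :
    greenOf P ι h ((lev P.L k : ℕ) : ℂ) (a' * ((lev P.L k : ℕ) : ℝ) ^ P.d) Γ U * deltaQOf P ι h ((lev P.L k : ℕ) : ℂ) (a' * ((lev P.L k : ℕ) : ℝ) ^ P.d) Γ U
      = 1 := by
  rw [greenOf]; exact Matrix.nonsing_inv_mul _ (isUnit_det_deltaQOf_of_regular P ι h hdist ha' hα hτ hU hT hγ)

/-- **`‖greenOf‖ ≤ 1/gammaV`** at a regular background — level-free. [folklore] -/
theorem opNorm_greenOf_le_of_regular (hdist : ∀ g : G, ‖ι g - 1‖ = dist1 g) (ha' : 0 < a') (hα : 0 ≤ α) (hτ : 0 ≤ τ)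
    (hU : ∀ b : PBond P j, ((lev P.L k : ℕ) : ℝ) * dist1 (U b) ≤ α)
    (hT : ∀ y jj μ (t : Fin (lev P.L k)), ‖transport (fine (lev P.L k) (unitMod P)) (transV (siteIdx P h) ι U) μ (Γ y jj μ t) - 1‖ ≤ τ)
    (hγ : 0 < gammaV (Fintype.card o) P.d a' α τ) :
    ‖greenOf P ι h ((lev P.L k : ℕ) : ℂ) (a' * ((lev P.L k : ℕ) : ℝ) ^ P.d) Γ U‖ ≤ (gammaV (Fintype.card o) P.d a' α τ)⁻¹ := by
  rw [greenOf]; exact opNorm_inv_le_of_coercive hγ (coercive_deltaQOf_of_regular P ι h hdist ha' hα hτ hU hT)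

/-! ### The standard contour system: `τ = e^{(d+1)α} − 1` -/

/-- the contour letter of the standard system. [folklore] -/
def tauStd (d : ℕ) (α : ℝ) : ℝ := Real.exp ((d + 1 : ℕ) * α) - 1

omit [Fintype o] [DecidableEq o] in
/-- `tauStd ≥ 0` for `α ≥ 0`. [folklore] -/
theorem tauStd_nonneg (d : ℕ) (hα : 0 ≤ α) : 0 ≤ tauStd d α := sub_nonneg.mpr (Real.one_le_exp (by positivity))

/-- **COERCIVITY for the standard contours**: `Coercive (gammaV (card o) d a′ α (tauStd d α)) (deltaQOf … (lev) (a′·lev^d) contour U)`. [folklore] -/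
theorem coercive_deltaQOf_contour (hdist : ∀ g : G, ‖ι g - 1‖ = dist1 g) (ha' : 0 < a') (hα : 0 ≤ α)
    (hU : ∀ b : PBond P j, ((lev P.L k : ℕ) : ℝ) * dist1 (U b) ≤ α) :
    Coercive (gammaV (Fintype.card o) P.d a' α (tauStd P.d α))
      (deltaQOf P ι h ((lev P.L k : ℕ) : ℂ) (a' * ((lev P.L k : ℕ) : ℝ) ^ P.d) (contour (lev P.L k) (unitMod P)) U) :=
  coercive_deltaQOf_of_regular P ι h hdist ha' hα (tauStd_nonneg P.d hα) hU (norm_transport_transV_contour_le P ι h hdist hα hU)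

/-- **`isUnit_deltaQOf_contour`**. [folklore] -/
theorem isUnit_deltaQOf_contour (hdist : ∀ g : G, ‖ι g - 1‖ = dist1 g) (ha' : 0 < a') (hα : 0 ≤ α)
    (hU : ∀ b : PBond P j, ((lev P.L k : ℕ) : ℝ) * dist1 (U b) ≤ α) (hγ : 0 < gammaV (Fintype.card o) P.d a' α (tauStd P.d α)) :
    IsUnit (deltaQOf P ι h ((lev P.L k : ℕ) : ℂ) (a' * ((lev P.L k : ℕ) : ℝ) ^ P.d) (contour (lev P.L k) (unitMod P)) U) :=
  isUnit_of_coercive hγ (coercive_deltaQOf_contour P ι h hdist ha' hα hU)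

/-- **`‖greenOf‖ ≤ 1/gammaV`** for the standard contours. [folklore] -/
theorem opNorm_greenOf_contour_le (hdist : ∀ g : G, ‖ι g - 1‖ = dist1 g) (ha' : 0 < a') (hα : 0 ≤ α)
    (hU : ∀ b : PBond P j, ((lev P.L k : ℕ) : ℝ) * dist1 (U b) ≤ α) (hγ : 0 < gammaV (Fintype.card o) P.d a' α (tauStd P.d α)) :
    ‖greenOf P ι h ((lev P.L k : ℕ) : ℂ) (a' * ((lev P.L k : ℕ) : ℝ) ^ P.d) (contour (lev P.L k) (unitMod P)) U‖
      ≤ (gammaV (Fintype.card o) P.d a' α (tauStd P.d α))⁻¹ := by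
  rw [greenOf]; exact opNorm_inv_le_of_coercive hγ (coercive_deltaQOf_contour P ι h hdist ha' hα hU)

end Summit.QuantumFields.BalabanUV.T4Continuum.CovariantVectorGreenOfField

end
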